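import Literature.IUT.HodgeArakelov.ThetaSettingCor112ModelTateOfKerNeBot
import Literature.IUT.HodgeArakelov.ThetaSettingDeltaCharacteristicAtModelTateUnconditional
import Literature.IUT.HodgeArakelov.GaloisPairCyclotomesCor111AtModelTateOfExtends
import HarnessLib

/-!
# [IUTchII] Cor. 1.12 (ii)∧(iii) AT THE TATE MODEL — the K-L6 cell of record as ONE declaration with displayed binders
# LITERALLY (hP) (hcharY) (huniq) (G) + the signature hypothesis `hextΔ`: F-0620@1 and (H1) `hΔX` BOTH SUPPLIED IN KERNEL
# (proof-only; D-0079 K-L6 row «COR112-OF-EXTENDS», abc-iut-L6-lead §F v1.19dp)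

S. Mochizuki, *Inter-universal Teichmüller theory II*, kurims manuscript (Dec. 2020), Cor. 1.12 (ii), (iii) pp. 56–58, Ex. 1.8 (i)
p. 35 [claim: Mochizuki2012, status: disputed] (IUTchII §1 Cor 1.12, kurims pp.56-58); S. Mochizuki, *The étale theta function …*,
Publ. RIMS **45** (2009) [EtTh], Thm. 1.6 (i) p. 24, Prop. 2.4 p. 38, Cor. 2.18 (i) p. 60 [cite: MochizukiEtTh2009, Cor 2.18(i) p.60];
S. Mochizuki, *Topics in absolute anabelian geometry I* [AbsTopI], Thm. 2.6 (v) p. 22 [cite: MochizukiAbsTopI2012, Thm 2.6 (v) p.22].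
Cell `abc-iut`, seat abc-iut-L6-t2 (gen 5), K-L6 row «COR112-OF-EXTENDS» (abc-iut-L6-lead §F v1.19dp 2026-08-27T03:08:37Z).
PROOF-ONLY: no definition, no instance, no new named fact; ONE application of LANDED theorems consumed BY NAME —
abc-iut-w4-d008's `ModelTateCarriers.cor112_model_modelTate_section_translates_of_ker_ne_bot` (p488290, over abc-iut-w4-d043's
record p477403), abc-iut-w4-d044's `SettingModel.ker_tatePairHom_ne_bot` (p488367) / `SettingModel.deltaX_characteristic_setting_modelχq_holds`
(p488629; abc-iut-L6-d6's row «COR112-HI0-PLUG» is the same plug as ONE declaration), and abc-iut-L6-t2's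
`ModelTateCarriers.levelRigid_cor218_i_modelTate_of_extends` (p490266, packaging abc-iut-L6-d6's p477049
`SettingModel.rigidData_cor218_i_modelχq_of_extends_of_mod_four_eq_one` at `i := 1`, `p ≡ 1 (mod 4)` forced by `4·l ∣ p − 1`).

WHAT. **`ModelTateCarriers.cor112_model_modelTate_section_translates_of_extends (hext : …)`** — p477403's telescope VERBATIM (same
`let`-data of record, same conclusion `Cor112_ii ∧ ∃ Δ : MuXmuDiagram …, Δ.poly₄₅ = {…}`), in which
* the (H1) binder `hΔX` is the `let`-term `SettingModel.deltaX_characteristic_setting_modelχq_holds …` (NO `hI0`: abc-iut-w4-d044's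
  `ker_tatePairHom_ne_bot` — «`ℚ_p(μ_∞, p^{1/∞}) ≠ ℚ̄_p`» — is a theorem of the tree), and
* the F-0620 binder `h218i₁` ([EtTh] Cor. 2.18 (i) at level `1` of the tower) is the `let`-term
  `levelRigid_cor218_i_modelTate_of_extends p l hl hdvd τ hext 1`,
so that the residual `∀`-binders are EXACTLY {`hP` (inhabited), (H1) `hcharY` = F-2633 at the instance, (R1) `huniq`, the isomorph
`G`} ∪ the signature hypothesis `hext` = `hextΔ` («every bi-continuous automorphism of `Π^tp_{X̲̲}` extends to a
`Δ^tp_X`-stabilising bi-continuous automorphism of `Π^tp_X`», [EtTh] Prop. 2.4 (i) shape). `hext` sits in the SIGNATURE on purpose: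
the gate's `dedup.landed` refuses a theorem whose type after the colon equals a landed one modulo Prop binders (measured on p490266's
dry-runs and on abc-iut-L6-d6 gen 7's three unfiled variants of this very plug, STATUS 2026-08-27T03:18:04Z — its variant (v3),
staged `HOME/staging/L6/L6-d6/g7/ThetaSettingCor112ModelTateOfExtends.unfiled.lean` sha16 d84e09bccd81974e, is THIS statement with
`hextΔ` as an inner `∀` and was written independently and concurrently: a concordance witness), whereas the same statement with the new
hypothesis as a signature argument passes (probe dry-run 03:1xZ) — and the honest display wants ONE declaration.

HONEST LABEL: `modelTate` / `modelχq p 1 2` is a SEMI-SYNTHETIC model of the typed [EtTh] §1 interface (no theta FUNCTION; not the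
tempered `π₁` of a curve): binder-discharge / joint-satisfiability evidence for the typed interface, not a statement about print.
`hextΔ` is a RE-KEYING of F-0620, not a net discharge: it is NOT decidable from tree theorems at the model (abc-iut-L6-d6 gen-5 census:
a statement about `Aut_top` of `Huuχq ≤ dUU_l ⋊ G_{ℚ_p}`; no analogue of print's `K`-coricity), it is DISPLAYED, not endorsed; what it
buys is that the displayed input moves UPSTREAM in print (Prop. 2.4 (i) is an input of Cor. 2.18 (i)'s proof) and is label-free and
mono-theta-free. Nothing of [IUTchII] (claim key `Mochizuki2012`, DISPUTED, D-0012) or [EtTh] / [AbsTopI] is asserted beyond the tree's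
proofs; F-2633 / `huniq` stay NAMED; no side is taken on [IUTchIII] Cor. 3.12; typed ≠ proved; instantiated ≠ endorsed; nothing here says
abc is proved or refuted.
-/

noncomputable section

namespace Literature.IUT.HodgeArakelov

open Literature.AnabelianGeometry.AbsoluteAnabelian
open Literature.AnabelianGeometry.EtaleTheta Literature.AnabelianGeometry.SemiGraphs CohomologySystemOfContH1
open Literature.AnabelianGeometry.EtaleTheta.SettingModel
open Literature.NumberTheory.GaloisRepresentations
open scoped Literature.AnabelianGeometry.EtaleTheta
open EtaleThetaDataOfSetting

namespace ModelTateCarriers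

variable (p : ℕ) [Fact p.Prime] (l : ℕ+) (hl : Odd (l : ℕ)) (hlp : (l : ℕ).Prime) (hdvd : 4 * (l : ℕ) ∣ p - 1)
  {Es : Set ℕ+} (τ : (ThetaSetting.modelχq p 1 2 even_two).CyclotomeTower l Es)

/-- **[IUTchII] Cor. 1.12 (ii) AND (iii) at the Tate model with `D_{μ_-} := Π^tp_{X̲̲} ∩ inr(G_{ℚ_p})`, FROM `hextΔ`: the (H1)
`Δ`-characteristic binder AND the F-0620 binder at level `1` BOTH SUPPLIED IN KERNEL.** abc-iut-w4-d043's
`cor112_model_modelTate_section_translates` (p477403) re-threaded through abc-iut-w4-d008's `…_of_ker_ne_bot` (p488290) at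
abc-iut-w4-d044's theorem `ker_tatePairHom_ne_bot` (p488367), with `h218i₁ := levelRigid_cor218_i_modelTate_of_extends … hext 1`
(p490266 over abc-iut-L6-d6's p477049); the `let`-data and the conclusion are p477403's VERBATIM. Residual `∀`-binders, each a NAMED
input: `hP` (inhabited), (H1) `hcharY` (F-2633 at the instance), (R1) `huniq`, `G`; signature hypothesis `hext` ([EtTh] Prop. 2.4 (i)
shape, DISPLAYED not endorsed). [claim: Mochizuki2012, status: disputed] (IUTchII §1 Cor 1.12 (ii)(iii), kurims pp.56-58)
[cite: MochizukiEtTh2009, Cor 2.18(i) p.60] -/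
theorem cor112_model_modelTate_section_translates_of_extends
    (hext : ∀ γ : ↥((((kummerCoreχq p 1 2 even_two).toKummerDataOfSection SemidirectProduct.inr
        (continuous_inrχq p 1 2) (fun _ => rfl) (map_inr_GK_le_GtpY_modelχq' p 1 2 even_two)
        (map_inr_GKdd_le_GtpYdd_modelχq' p 1 2 even_two)).etaleThetaDataOfClass
        (etaDdχq p 1 2 even_two)).doubleUnderlineχqOfEtaRes p 1 2 l hl (eta_res_etaDdχq p 1 2 even_two l hl)).Huu ≃ₜ* ↥((((kummerCoreχq p 1 2 even_two).toKummerDataOfSection SemidirectProduct.inr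
        (continuous_inrχq p 1 2) (fun _ => rfl) (map_inr_GK_le_GtpY_modelχq' p 1 2 even_two)
        (map_inr_GKdd_le_GtpYdd_modelχq' p 1 2 even_two)).etaleThetaDataOfClass
        (etaDdχq p 1 2 even_two)).doubleUnderlineχqOfEtaRes p 1 2 l hl (eta_res_etaDdχq p 1 2 even_two l hl)).Huu,
      ∃ Γ : PiTpχq p 1 2 ≃ₜ* PiTpχq p 1 2,
        (∀ h : ((((kummerCoreχq p 1 2 even_two).toKummerDataOfSection SemidirectProduct.inr
        (continuous_inrχq p 1 2) (fun _ => rfl) (map_inr_GK_le_GtpY_modelχq' p 1 2 even_two)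
        (map_inr_GKdd_le_GtpYdd_modelχq' p 1 2 even_two)).etaleThetaDataOfClass
        (etaDdχq p 1 2 even_two)).doubleUnderlineχqOfEtaRes p 1 2 l hl (eta_res_etaDdχq p 1 2 even_two l hl)).Huu,
          Γ (h : PiTpχq p 1 2) = ((γ h : ((((kummerCoreχq p 1 2 even_two).toKummerDataOfSection SemidirectProduct.inr
        (continuous_inrχq p 1 2) (fun _ => rfl) (map_inr_GK_le_GtpY_modelχq' p 1 2 even_two)
        (map_inr_GKdd_le_GtpYdd_modelχq' p 1 2 even_two)).etaleThetaDataOfClass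
        (etaDdχq p 1 2 even_two)).doubleUnderlineχqOfEtaRes p 1 2 l hl (eta_res_etaDdχq p 1 2 even_two l hl)).Huu) : PiTpχq p 1 2)) ∧
        (curveχq p 1 2).DeltaTemp.map Γ.toMulEquiv.toMonoidHom = (curveχq p 1 2).DeltaTemp) :
    -- the [EtTh] §1 data of record at the Tate model (every clause a theorem of abc-iut-L2)
    let hC := compat_modelχq p 1 2 even_two
    let hS := ThetaSetting.modelχq_sec2Hyps p 1 2 even_two
    -- (R1) AT THE TATE MODEL: abc-iut-L2's stage-2 inversion `ι := inversionχq` of `Π^tp_X` (over `K`, `−1` on `Z`, involutive)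
    let ι := inversionχq p 1 2
    let hιA : (ThetaSetting.modelχq p 1 2 even_two).IsInversionAut ι := isInversionAut_inversionχq p 1 2 even_two
    -- THE POINT `μ_-` OF THE MODEL: the Galois section of record `inr(G_{ℚ_p}) ≤ Π^tp_X`, FIXED by `ι` (its trace on `Π^tp_{X̲̲}` is `D_{μ_-}`)
    let Dsec : Subgroup (PiTpχq p 1 2) := (SemidirectProduct.inr : GQp p →* PiTpχq p 1 2).range
    let K₀ := (kummerCoreχq p 1 2 even_two).toKummerDataOfSection SemidirectProduct.inr (continuous_inrχq p 1 2)
        (fun _ => rfl) (map_inr_GK_le_GtpY_modelχq' p 1 2 even_two) (map_inr_GKdd_le_GtpYdd_modelχq' p 1 2 even_two)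
    let C := (K₀.etaleThetaDataOfClass (etaDdχq p 1 2 even_two)).doubleUnderlineχqOfEtaRes p 1 2 l hl
        (eta_res_etaDdχq p 1 2 even_two l hl)
    -- the ROOT COCYCLE of the `EtaleLevels` chain: abc-iut-L6-t1's one-root lift (abc-iut-w5-d233 `rootLift_mem_rootCocycles`)
    let f := EtaleThetaDataOfSetting.rootLift C
    let hf : f ∈ C.rootCocycles hC := rootLift_mem_rootCocycles C hC
    let h15 : Literature.AnabelianGeometry.EtaleTheta.ThetaSetting.Prop15iii _ hC :=
      prop15iii_etaleThetaDataOfClass_etaDdχq p hC SemidirectProduct.inr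
        (continuous_inrχq p 1 2) (fun _ => rfl) (map_inr_GK_le_GtpY_modelχq' p 1 2 even_two)
        (map_inr_GKdd_le_GtpYdd_modelχq' p 1 2 even_two)
    let L : C.CuspLabels := ⟨fun _ => ∅, fun _ => ∅, fun _ => rfl⟩
    let hO := ThetaSetting.modelχq_isEtThOrigin p 1 2 even_two
    let hYcl := hYcl_modelχq p 1 2 even_two
    let hp2 := ne_two_of_four_mul_dvd_pred p l.pos hdvd
    let hpl := ne_of_four_mul_dvd_pred p l.pos hdvd
    let hζ := exists_isPrimitiveRoot_K_modelχq p 1 2 even_two l.pos hdvd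
    let hZ : ∀ M : ℕ+, Nonempty (ModelCyclotomes.lDeltaQuot (C.rigidData (τ.modAll M) hC hS h15 L) ≃*
        Literature.IUT.HodgeTheaters.ZHat) := fun M =>
      ModelCyclotomes.nonempty_lDeltaQuot_rigidData_mulEquiv_zHat C (τ.modAll M) hC hS h15 L hO hYcl hlp.ne_zero
    -- the generic instances of the Cor. 1.12 vocabulary, re-supplied at the (reducible) Tate-model carriers
    haveI : ((ThetaSetting.modelχq p 1 2 even_two).lDeltaTheta l).Normal := (ThetaSetting.modelχq p 1 2 even_two).lDeltaTheta_normal l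
    haveI : IsMulCommutative ((ThetaSetting.modelχq p 1 2 even_two).lDeltaTheta l) :=
      EtaleThetaDataOfSetting.instIsMulCommutative_lDeltaTheta (D := ThetaSetting.modelχq p 1 2 even_two) l
    letI : MulDistribMulAction (EtaleThetaDataOfSetting.Pi C) (PadicAlgCl p)ˣ := EtaleThetaDataOfSetting.unitsAction C
    -- (H2) `Π/Δ ≅ G_K` at the `EtaleLevels` setting of the Tate model: abc-iut-w4-d030's THEOREM `hq_setting_modelTate` (p456925)
    let hq : Nonempty (TopGroup.quot (EtaleLevels.setting C hC hS hlp hp2 hpl hζ τ.modAll f hf).PiX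
        (EtaleLevels.setting C hC hS hlp hp2 hpl hζ τ.modAll f hf).DeltaX ≃ₜ*
        (EtaleLevels.setting C hC hS hlp hp2 hpl hζ τ.modAll f hf).Gk) :=
      hq_setting_modelTate p l hl hlp hdvd τ
    -- `ι` stabilises `Π^tp_X̲̲`; `α := ι|Π^tp_X̲̲` (abc-iut-w5-d072 `inversionAlpha`); `δ := 1`; a `toLZ`-generator `γ`
    let hι : C.Huu.map ι.toMulEquiv.toMonoidHom = C.Huu := map_Huuχq_inversionχq p 1 2 l hl
    let α : (EtaleThetaDataOfSetting.Pi C) ≃ₜ* (EtaleThetaDataOfSetting.Pi C) := EtaleThetaDataOfSetting.inversionAlpha C ι hι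
    let hαα : ∀ x : EtaleThetaDataOfSetting.Pi C, α (α x) = 1 * x * 1⁻¹ :=
      EtaleThetaDataOfSetting.inversionAlpha_inversionAlpha_of_sq C ι hι 1
        (EtaleThetaDataOfSetting.sq_conj_one_of_involutive C ι (inversionχq_inversionχq p 1 2))
    let γ : EtaleThetaDataOfSetting.Pi C := (C.toLZ_surjective (Multiplicative.ofAdd 1)).choose
    let hγ : C.toLZ γ = Multiplicative.ofAdd 1 := (C.toLZ_surjective (Multiplicative.ofAdd 1)).choose_spec
    let hαγ : C.toLZ (α γ) = Multiplicative.ofAdd (-1) :=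
      EtaleThetaDataOfSetting.toLZ_inversionAlpha_generator C ι hι γ hγ (hιA.toZ_apply γ)
    -- the [IUTchII] Prop. 1.2 (i) output `Env₀ :=` abc-iut-L6-d6's GENUINE `ThetaSetting.envOfGroup` of the Tate curve (bridge B8), for
    -- EVERY identification `hP` (inhabited: `⟨ContinuousMulEquiv.refl _⟩`); its `projG ∘ isoX` kills exactly `Ker(aug)` modulo F-0620
    ∀ (hP : Nonempty ((EtaleThetaDataOfSetting.Pi C) ≃ₜ* (EtaleLevels.setting C hC hS hlp hp2 hpl hζ τ.modAll f hf).PiX)),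
    let Env₀ : EnvOfGroup (EtaleLevels.setting C hC hS hlp hp2 hpl hζ τ.modAll f hf)
        (EtaleLevels.modelSystem C hC hS hlp hp2 hpl hζ τ.modAll f hf τ.red_modAll h15 L hZ).PiX :=
      ThetaSetting.envOfGroup (C.rigidData (τ.modAll 1) hC hS h15 L)
        (ThetaSetting.SideData.ofDoubleUnderline C (τ.modAll 1) hC hS hlp hp2 hpl hζ (EtaleLevels.eta0_mem C hC hS τ.modAll f hf 1))
        (ThetaSetting.t1Space_Huu C) (ThetaSetting.isClosed_ker_aug_thetaEnvData C (τ.modAll 1) hC hS) (hZ 1)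
        (EtaleThetaDataOfSetting.Pi C) hP
    let hδ : Env₀.recon.projG (Env₀.isoX 1) = 1 :=
      EtaleThetaDataOfSetting.projG_isoX_envOfGroup_one C (τ.modAll 1) hC hS h15 L hlp hp2 hpl hζ
        (EtaleLevels.eta0_mem C hC hS τ.modAll f hf 1) (hZ 1) hP
    -- RESIDUAL named inputs: F-0620 ([EtTh] Cor. 2.18 (i)) at level `1` of `τ` — from which `hover` FOLLOWS (p461458) — then (H1)
    -- `hcharY`, after which the POINT DATA of `D_{μ_-} := Π^tp_{X̲̲} ∩ inr(G_{ℚ_p})` are THEOREMS (§1), then the rest of the custody list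
    -- F-0620 at level `1`: NO LONGER a `∀`-binder — abc-iut-L6-d6's Thm. 1.6 (i)-class theorem at the model (p477049, `p ≡ 1 (4)`
    -- forced by `4·l ∣ p − 1`) packaged as abc-iut-L6-t2's `levelRigid_cor218_i_modelTate_of_extends` (p490266), from `hext`
    let h218i₁ : (C.rigidData (τ.modAll 1) hC hS h15 L).Cor218_i :=
      levelRigid_cor218_i_modelTate_of_extends p l hl hdvd τ hext 1
    let hover : ∀ x : EtaleThetaDataOfSetting.Pi C, Env₀.recon.projG (Env₀.isoX (α x)) = Env₀.recon.projG (Env₀.isoX x) :=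
      fun x => EtaleThetaDataOfSetting.projG_isoX_envOfGroup_inversionAlpha_of_cor218_i C ι hι (τ.modAll 1) hC hS h15 L hlp
        hp2 hpl hζ (EtaleLevels.eta0_mem C hC hS τ.modAll f hf 1) (hZ 1) hP _ rfl h218i₁ hιA x
    ∀ (hcharY : EtaleThetaDataOfSetting.PiYddCharacteristic C),
    -- «y = μ_-» AT THE MODEL, EVERY point clause a THEOREM: `D_{μ_-} := Π^tp_{X̲̲} ∩ inr(G_{ℚ_p})`, the `ι`-FIXED Galois section
    -- of record (`inversionχq_inr` at `(i, j) = (1, 2)`), inside `Π_Ÿ(Π)` since `K̈ = K` (`hDmu`), compact, `D_{μ_-} ∩ Δ = 1`,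
    -- `aug(D_{μ_-}) = G_K`; «fixed by `ι_Ÿ` up to `Π_Ÿ(Π)`-conjugacy» with `δ' := 1` (`hfixD`)
    let Dμ : Subgroup (EtaleThetaDataOfSetting.Pi C) := Dsec.subgroupOf C.Huu
    let hDmu : Dμ ≤ EtaleThetaDataOfSetting.PiYdd C := inrRange_subgroupOf_le_piYdd p 1 2 even_two C hS
    let hfixD : ∃ δ' : ↥(EtaleThetaDataOfSetting.PiYdd C), Env₀.recon.projG (Env₀.isoX (δ' : EtaleThetaDataOfSetting.Pi C)) = 1 ∧
        ∀ (d : EtaleThetaDataOfSetting.Pi C) (hd : d ∈ Dμ),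
          ((EtaleThetaDataOfSetting.iotaYddOfAut C hcharY α ⟨d, hDmu hd⟩ :
          EtaleThetaDataOfSetting.PiYdd C) : EtaleThetaDataOfSetting.Pi C) ∈
            Dμ.map (MulAut.conj ((δ' : EtaleThetaDataOfSetting.PiYdd C) : EtaleThetaDataOfSetting.Pi C)).toMonoidHom :=
      exists_fixD_inrRange_subgroupOf p C hι hcharY hS (fun x => Env₀.recon.projG (Env₀.isoX x) = 1) hδ
    ∀ -- (R1) residual: the UNIQUENESS clause only («the unique order two `Δ`-outer automorphism over `G_k`», tempered-anabelian)
      (huniq : ∀ κ : (EtaleThetaDataOfSetting.Pi C) ≃ₜ* (EtaleThetaDataOfSetting.Pi C),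
        (∀ x, Env₀.recon.projG (Env₀.isoX (κ x)) = Env₀.recon.projG (Env₀.isoX x)) →
        (∃ δ' : EtaleThetaDataOfSetting.Pi C, Env₀.recon.projG (Env₀.isoX δ') = 1 ∧ ∀ x, κ (κ x) = δ' * x * δ'⁻¹) →
        (¬ ∃ δ' : EtaleThetaDataOfSetting.Pi C, Env₀.recon.projG (Env₀.isoX δ') = 1 ∧ ∀ x, κ x = δ' * x * δ'⁻¹) →
          ∃ δ' : EtaleThetaDataOfSetting.Pi C, Env₀.recon.projG (Env₀.isoX δ') = 1 ∧ ∀ x, κ x = δ' * α x * δ'⁻¹)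
        ,
    -- «STANDARD TYPE AT `D_{μ_-}`», NOW A THEOREM: `etaStd :=` the ROOT member of the orbit `η̈^{Θ,l·ℤ×μ₂}` (σ₀ = 1); its restriction to
    -- `D_{μ_-} ⊆ inr(G_{ℚ_p})` is `2l`-torsion because `η̈♯ = infl(z-class)` DIES on the Galois section (`hstd_rootMember_of_section`)
    let etaStd : (EtaleThetaDataOfSetting.coh C).H1 ⊤ :=
      (EtaleThetaDataOfSetting.h1Top C).symm (Additive.ofMul (EtaleThetaDataOfSetting.rootLiftClass C))
    let hmem : etaStd ∈ EtaleThetaDataOfSetting.orbitOne C hC :=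
      ⟨1, by haveI := EtaleThetaDataOfSetting.piYdd_normal C hC; rw [ContH1.conj_one_apply]⟩
    let hstd : (2 * (EtaleLevels.setting C hC hS hlp hp2 hpl hζ τ.modAll f hf).l) •
        EtaleThetaDataOfSetting.resDmuOf C Dμ hDmu etaStd = 0 :=
      hstd_rootMember_of_section p 1 2 even_two C rfl Dμ hDmu fun d hd => (mem_inrRange_subgroupOf_iff p 1 2 even_two C d).1 hd
    -- THE COEFFICIENT HALF OF THE PAIR, NOW A THEOREM: `β := ι^Θ`, abc-iut's `thetaCompanionOfAut` of the stage-2 inversion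
    -- (`IsInversionAut.map_deltaTemp`, `hasThetaTopology_modelχq`); `hφ` by construction, `hβ` = `thetaIso_inversionχq_apply_eq_self`
    let cι := (ThetaSetting.modelχq p 1 2 even_two).thetaCompanionOfAut ι hιA.map_deltaTemp
      (hasThetaTopology_modelχq p 1 2 even_two).isQuotientMap_toTheta
    let β : (ThetaSetting.modelχq p 1 2 even_two).GtpTheta ≃ₜ* (ThetaSetting.modelχq p 1 2 even_two).GtpTheta := cι.thetaIso
    let hφ : ∀ g, β (EtaleThetaDataOfSetting.phi C g) = EtaleThetaDataOfSetting.phi C (α g) := fun g => by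
      change cι.thetaIso ((ThetaSetting.modelχq p 1 2 even_two).toTheta (g : PiTpχq p 1 2)) =
        (ThetaSetting.modelχq p 1 2 even_two).toTheta ((α g : EtaleThetaDataOfSetting.Pi C) : PiTpχq p 1 2)
      rw [EtaleThetaDataOfSetting.coe_inversionAlpha]
      exact (ThetaSetting.modelχq p 1 2 even_two).thetaCompanionOfAut_thetaIso_toTheta ι hιA.map_deltaTemp _ _
    let hβ : ∀ a : (ThetaSetting.modelχq p 1 2 even_two).GtpTheta, a ∈ (ThetaSetting.modelχq p 1 2 even_two).lDeltaTheta l → β a = a :=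
      fun a ha => thetaIso_inversionχq_apply_eq_self p 1 2 even_two cι ((ThetaSetting.modelχq p 1 2 even_two).lDeltaTheta_le l ha)
    -- THE PROP. 2.2 (ii) TRANSLATES OF THE STANDARD CLASS `tr n := γⁿ · η̲̈^Θ` (the `γⁿ`-conjugates of the root class) with `htr`,
    -- `hdesc`, `hrev`, `hfree` are THEOREMS here (built in the proof: `translates_rootMember_modelχq`, with [EtTh] Prop. 1.5 (ii) for the
    -- section datum = abc-iut-L2-t8's `prop13_prop15_sectionData_modelTate`), so they no longer appear in the telescope.
    -- (H1) `Δ` characteristic (⟺ MChar, p466815) is NOT A BINDER: it is abc-iut-w4-d044's THEOREM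
    -- `SettingModel.deltaX_characteristic_setting_modelχq_holds` (p488629 = p486362 ∘ p488367; abc-iut-L6-d6's «COR112-HI0-PLUG»)
    let hΔX : ∀ φ : (EtaleLevels.setting C hC hS hlp hp2 hpl hζ τ.modAll f hf).PiX ≃ₜ* (EtaleLevels.setting C hC hS hlp hp2 hpl hζ τ.modAll f hf).PiX,
        (EtaleLevels.setting C hC hS hlp hp2 hpl hζ τ.modAll f hf).DeltaX.map φ.toMulEquiv.toMonoidHom =
          (EtaleLevels.setting C hC hS hlp hp2 hpl hζ τ.modAll f hf).DeltaX :=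
      SettingModel.deltaX_characteristic_setting_modelχq_holds p 1 2 even_two C hC hS hlp hp2 hpl hζ τ.modAll f hf
    ∀ -- RESIDUAL, ALL ANABELIAN: the isomorph `G` (the earlier `hP`, F-2633 `hcharY`, (R1) `huniq`) — plus the signature's `hext`
      (G : IsoClass (EtaleLevels.setting C hC hS hlp hp2 hpl hζ τ.modAll f hf).Gk),
      haveI := finiteIndex_map_aug_inrRange_subgroupOf p 1 2 even_two C (inr_mem_Huuχq p 1 2 l hl)
      ∃ cU : CyclotomeCoefficients (EtaleThetaDataOfSetting.phi C) ((ThetaSetting.modelχq p 1 2 even_two).lDeltaTheta l) (PadicAlgCl p)ˣ,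
        Function.Bijective cU.hom ∧
        (∀ (ζ : Literature.AnabelianGeometry.EtaleTheta.cyclotome (PadicAlgCl p)ˣ) (M : ℕ+),
          (((τ.modAll M).red (cU.hom ζ) : MuN p M) : (PadicAlgCl p)ˣ) = (ζ : ℕ+ → (PadicAlgCl p)ˣ) M) ∧
        Literature.IUT.HodgeArakelov.Cor112_ii
          (EtaleLevels.thetaEvaluation C hC hS hlp hp2 hpl hζ τ.modAll f hf τ.red_modAll h15 L hZ hcharY (EtaleLevels.bijective_rigidLimHom C hC hS hlp hp2 hpl hζ τ.modAll f hf τ.red_modAll h15 L hZ) Env₀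
            (EtaleThetaDataOfSetting.pointedInversionOfPair C hC hS hcharY (EtaleLevels.setting C hC hS hlp hp2 hpl hζ τ.modAll f hf)
              (ContinuousMulEquiv.refl _) rfl Env₀ α hover 1 hδ hαα γ hγ hαγ huniq Dμ hDmu hfixD etaStd hmem hstd)
            (LevelRetraction.ofAugmentation (EtaleThetaDataOfSetting.phi C) ((ThetaSetting.modelχq p 1 2 even_two).lDeltaTheta l)
              (EtaleThetaDataOfSetting.aug C) Dμ (eq_one_of_mem_inrRange_subgroupOf_of_aug_eq_one p 1 2 even_two C) (EtaleThetaDataOfSetting.PiYdd C)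
              (EtaleThetaDataOfSetting.continuous_aug C) (EtaleLevels.aug_ker_acts_trivially C)
              (hlift_of_isCompact (EtaleThetaDataOfSetting.aug C) Dμ (EtaleThetaDataOfSetting.continuous_aug C) (isCompact_inrRange_subgroupOf p 1 2 even_two C (inr_mem_Huuχq p 1 2 l hl)))
              (hemb_of_isCompact (EtaleThetaDataOfSetting.aug C) Dμ (EtaleThetaDataOfSetting.continuous_aug C) (isCompact_inrRange_subgroupOf p 1 2 even_two C (inr_mem_Huuχq p 1 2 l hl)) (eq_one_of_mem_inrRange_subgroupOf_of_aug_eq_one p 1 2 even_two C)))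
            cU (EtaleThetaDataOfSetting.isOpen_stabilizer_units C) (EtaleThetaDataOfSetting.finiteIndex_stabilizer_units C)
            (unitGroup ℚ_[p] (PadicAlgCl p)) (EtaleThetaDataOfSetting.pairRhoLim C α β hφ (EtaleThetaDataOfSetting.mem_lDeltaTheta_iff_of_eq_self β hβ) (EtaleThetaDataOfSetting.mem_PiYdd_iff_of_piYddCharacteristic C hcharY α))) ∧
        ∃ Δ : MuXmuDiagram
            (EtaleLevels.thetaEvaluation C hC hS hlp hp2 hpl hζ τ.modAll f hf τ.red_modAll h15 L hZ hcharY (EtaleLevels.bijective_rigidLimHom C hC hS hlp hp2 hpl hζ τ.modAll f hf τ.red_modAll h15 L hZ) Env₀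
              (EtaleThetaDataOfSetting.pointedInversionOfPair C hC hS hcharY (EtaleLevels.setting C hC hS hlp hp2 hpl hζ τ.modAll f hf)
                (ContinuousMulEquiv.refl _) rfl Env₀ α hover 1 hδ hαα γ hγ hαγ huniq Dμ hDmu hfixD etaStd hmem hstd)
              (LevelRetraction.ofAugmentation (EtaleThetaDataOfSetting.phi C) ((ThetaSetting.modelχq p 1 2 even_two).lDeltaTheta l)
                (EtaleThetaDataOfSetting.aug C) Dμ (eq_one_of_mem_inrRange_subgroupOf_of_aug_eq_one p 1 2 even_two C) (EtaleThetaDataOfSetting.PiYdd C)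
                (EtaleThetaDataOfSetting.continuous_aug C) (EtaleLevels.aug_ker_acts_trivially C)
                (hlift_of_isCompact (EtaleThetaDataOfSetting.aug C) Dμ (EtaleThetaDataOfSetting.continuous_aug C) (isCompact_inrRange_subgroupOf p 1 2 even_two C (inr_mem_Huuχq p 1 2 l hl)))
                (hemb_of_isCompact (EtaleThetaDataOfSetting.aug C) Dμ (EtaleThetaDataOfSetting.continuous_aug C) (isCompact_inrRange_subgroupOf p 1 2 even_two C (inr_mem_Huuχq p 1 2 l hl)) (eq_one_of_mem_inrRange_subgroupOf_of_aug_eq_one p 1 2 even_two C)))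
              cU (EtaleThetaDataOfSetting.isOpen_stabilizer_units C) (EtaleThetaDataOfSetting.finiteIndex_stabilizer_units C)
              (unitGroup ℚ_[p] (PadicAlgCl p)) (EtaleThetaDataOfSetting.pairRhoLim C α β hφ (EtaleThetaDataOfSetting.mem_lDeltaTheta_iff_of_eq_self β hβ) (EtaleThetaDataOfSetting.mem_PiYdd_iff_of_piYddCharacteristic C hcharY α)))
            (AbsTopMonoids.genuineOfModelIsm (EtaleLevels.setting C hC hS hlp hp2 hpl hζ τ.modAll f hf) (ThetaSetting.modelχq p 1 2 even_two).toTemperedCurve.mlfClosurePadic (ThetaSetting.modelχq p 1 2 even_two).toTemperedCurve.galoisEpsilonPadic hΔX hq) G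
            ↥(AddCommGroup.torsion (EtaleLevels.thetaEnvData C hC hS hlp hp2 hpl hζ τ.modAll f hf τ.red_modAll h15 L hZ hcharY (EtaleLevels.bijective_rigidLimHom C hC hS hlp hp2 hpl hζ τ.modAll f hf τ.red_modAll h15 L hZ)).cohEnv.lim)
            (AddCommGroup.torsion (EtaleLevels.thetaEnvData C hC hS hlp hp2 hpl hζ τ.modAll f hf τ.red_modAll h15 L hZ hcharY (EtaleLevels.bijective_rigidLimHom C hC hS hlp hp2 hpl hζ τ.modAll f hf τ.red_modAll h15 L hZ)).cohEnv.lim).subtype,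
          Δ.poly₄₅ = {e | ∃ (φ : AbsTopMonoids.Genuine.qObj hq (IsoClass.base (EtaleLevels.setting C hC hS hlp hp2 hpl hζ τ.modAll f hf).PiX) ⟶ G)
              (gI : (AbsTopMonoids.genuineOfModelIsm (EtaleLevels.setting C hC hS hlp hp2 hpl hζ τ.modAll f hf) (ThetaSetting.modelχq p 1 2 even_two).toTemperedCurve.mlfClosurePadic
                (ThetaSetting.modelχq p 1 2 even_two).toTemperedCurve.galoisEpsilonPadic hΔX hq).Ism G),
            ∀ (u : ↥(unitGroup ℚ_[p] (PadicAlgCl p)))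
              (m : ↥(EtaleLevels.thetaEvaluation C hC hS hlp hp2 hpl hζ τ.modAll f hf τ.red_modAll h15 L hZ hcharY (EtaleLevels.bijective_rigidLimHom C hC hS hlp hp2 hpl hζ τ.modAll f hf τ.red_modAll h15 L hZ) Env₀
                (EtaleThetaDataOfSetting.pointedInversionOfPair C hC hS hcharY (EtaleLevels.setting C hC hS hlp hp2 hpl hζ τ.modAll f hf)
                  (ContinuousMulEquiv.refl _) rfl Env₀ α hover 1 hδ hαα γ hγ hαγ huniq Dμ hDmu hfixD etaStd hmem hstd)
                (LevelRetraction.ofAugmentation (EtaleThetaDataOfSetting.phi C) ((ThetaSetting.modelχq p 1 2 even_two).lDeltaTheta l)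
                  (EtaleThetaDataOfSetting.aug C) Dμ (eq_one_of_mem_inrRange_subgroupOf_of_aug_eq_one p 1 2 even_two C) (EtaleThetaDataOfSetting.PiYdd C)
                  (EtaleThetaDataOfSetting.continuous_aug C) (EtaleLevels.aug_ker_acts_trivially C)
                  (hlift_of_isCompact (EtaleThetaDataOfSetting.aug C) Dμ (EtaleThetaDataOfSetting.continuous_aug C) (isCompact_inrRange_subgroupOf p 1 2 even_two C (inr_mem_Huuχq p 1 2 l hl)))
                  (hemb_of_isCompact (EtaleThetaDataOfSetting.aug C) Dμ (EtaleThetaDataOfSetting.continuous_aug C) (isCompact_inrRange_subgroupOf p 1 2 even_two C (inr_mem_Huuχq p 1 2 l hl)) (eq_one_of_mem_inrRange_subgroupOf_of_aug_eq_one p 1 2 even_two C)))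
                cU (EtaleThetaDataOfSetting.isOpen_stabilizer_units C) (EtaleThetaDataOfSetting.finiteIndex_stabilizer_units C)
                (unitGroup ℚ_[p] (PadicAlgCl p)) (EtaleThetaDataOfSetting.pairRhoLim C α β hφ (EtaleThetaDataOfSetting.mem_lDeltaTheta_iff_of_eq_self β hβ) (EtaleThetaDataOfSetting.mem_PiYdd_iff_of_piYddCharacteristic C hcharY α))).MxTM)
              (w : (nonzeroIntegers (ThetaSetting.modelχq p 1 2 even_two).toTemperedCurve.mlfClosurePadic.k (ThetaSetting.modelχq p 1 2 even_two).toTemperedCurve.mlfClosurePadic.K)ˣ),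
              (m : (EtaleLevels.thetaEvaluation C hC hS hlp hp2 hpl hζ τ.modAll f hf τ.red_modAll h15 L hZ hcharY (EtaleLevels.bijective_rigidLimHom C hC hS hlp hp2 hpl hζ τ.modAll f hf τ.red_modAll h15 L hZ) Env₀
                (EtaleThetaDataOfSetting.pointedInversionOfPair C hC hS hcharY (EtaleLevels.setting C hC hS hlp hp2 hpl hζ τ.modAll f hf)
                  (ContinuousMulEquiv.refl _) rfl Env₀ α hover 1 hδ hαα γ hγ hαγ huniq Dμ hDmu hfixD etaStd hmem hstd)
                (LevelRetraction.ofAugmentation (EtaleThetaDataOfSetting.phi C) ((ThetaSetting.modelχq p 1 2 even_two).lDeltaTheta l)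
                  (EtaleThetaDataOfSetting.aug C) Dμ (eq_one_of_mem_inrRange_subgroupOf_of_aug_eq_one p 1 2 even_two C) (EtaleThetaDataOfSetting.PiYdd C)
                  (EtaleThetaDataOfSetting.continuous_aug C) (EtaleLevels.aug_ker_acts_trivially C)
                  (hlift_of_isCompact (EtaleThetaDataOfSetting.aug C) Dμ (EtaleThetaDataOfSetting.continuous_aug C) (isCompact_inrRange_subgroupOf p 1 2 even_two C (inr_mem_Huuχq p 1 2 l hl)))
                  (hemb_of_isCompact (EtaleThetaDataOfSetting.aug C) Dμ (EtaleThetaDataOfSetting.continuous_aug C) (isCompact_inrRange_subgroupOf p 1 2 even_two C (inr_mem_Huuχq p 1 2 l hl)) (eq_one_of_mem_inrRange_subgroupOf_of_aug_eq_one p 1 2 even_two C)))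
                cU (EtaleThetaDataOfSetting.isOpen_stabilizer_units C) (EtaleThetaDataOfSetting.finiteIndex_stabilizer_units C)
                (unitGroup ℚ_[p] (PadicAlgCl p)) (EtaleThetaDataOfSetting.pairRhoLim C α β hφ (EtaleThetaDataOfSetting.mem_lDeltaTheta_iff_of_eq_self β hβ) (EtaleThetaDataOfSetting.mem_PiYdd_iff_of_piYddCharacteristic C hcharY α))).Hd) =
                  Multiplicative.toAdd (h1LimKummer (EtaleThetaDataOfSetting.phi C) ((ThetaSetting.modelχq p 1 2 even_two).lDeltaTheta l) Dμ cU
                    (EtaleThetaDataOfSetting.isOpen_stabilizer_units C) (EtaleThetaDataOfSetting.finiteIndex_stabilizer_units C) u) →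
              ((w : nonzeroIntegers (ThetaSetting.modelχq p 1 2 even_two).toTemperedCurve.mlfClosurePadic.k (ThetaSetting.modelχq p 1 2 even_two).toTemperedCurve.mlfClosurePadic.K) :
                  (ThetaSetting.modelχq p 1 2 even_two).toTemperedCurve.mlfClosurePadic.K) = ((u : (PadicAlgCl p)ˣ) : PadicAlgCl p) →
                e (Multiplicative.ofAdd (QuotientAddGroup.mk m)) =
                  (AbsTopMonoids.genuineOfModelIsm (EtaleLevels.setting C hC hS hlp hp2 hpl hζ τ.modAll f hf) (ThetaSetting.modelχq p 1 2 even_two).toTemperedCurve.mlfClosurePadic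
                      (ThetaSetting.modelχq p 1 2 even_two).toTemperedCurve.galoisEpsilonPadic hΔX hq).actIsm G gI
                    (QuotientGroup.mk (Units.map (AbsTopMonoids.Genuine.liftM (ThetaSetting.modelχq p 1 2 even_two).toTemperedCurve.mlfClosurePadic
                      (AbsTopMonoids.Genuine.phiOf (ThetaSetting.modelχq p 1 2 even_two).toTemperedCurve.mlfClosurePadic (ThetaSetting.modelχq p 1 2 even_two).toTemperedCurve.galoisEpsilonPadic φ)).toMonoidHom w))} := by
  intro hC hS ι hιA Dsec K₀ C f hf h15 L hO hYcl hp2 hpl hζ hZ hq hι α hαα γ hγ hαγ hP Env₀ hδ h218i₁ hover hcharY Dμ hDmu hfixD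
    huniq etaStd hmem hstd cι β hφ hβ hΔX G
  exact cor112_model_modelTate_section_translates_of_ker_ne_bot p l hl hlp hdvd τ
    (SettingModel.ker_tatePairHom_ne_bot p 1 2) hP h218i₁ hcharY huniq G

end ModelTateCarriers

end Literature.IUT.HodgeArakelov

end
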